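import Literature.AlgebraicGeometry.Motives.CartierDivisorFibreSections
import Literature.AlgebraicGeometry.Motives.GrothendieckComplexCech
import Literature.Algebra.Homology.OrderedCechBaseChange
import HarnessLib

/-!
# `H⁰(X_t, 𝒪(D_t)) ≅ Ker(d⁰_Č ⊗ κ(t))`: the Čech complex of `𝒪(D)` computes `H⁰` of the fibres
# (Görtz–Wedhorn II, (23.28.5) in degree `0`; discharge of `cechComplex_h0_fibre`)

`Motives/GrothendieckComplexCech` reduces the degree-`0` Grothendieck complex `grothendieckComplex_h0`
of `𝒪(D)` on `pr_T : X ×_K T → T` (`Motives/SemicontinuityGrothendieckComplex`; locally on `T` a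
matrix of regular functions computes `H⁰(X_t, 𝒪(D_t))`, the passage from finitely generated
projective modules to matrices being the linear algebra of `Motives/GrothendieckComplexH0Projective`)
to two named facts about the ordered Čech complex `Č• = Č•(𝔚, 𝒪(D)|_{pr_T⁻¹V})` of
`Motives/CartierDivisorCech` over an affine open `V ⊆ T`: `cechComplex_perfect` (Görtz–Wedhorn II,
Cor. 23.135 / Thm. 23.133 — deep) and `cechComplex_h0_fibre` ((23.28.5) in degree `0`:
`H⁰(X_t, 𝒪(D_t)) ≅ Ker(d⁰_Č ⊗ κ(t))` — elementary). This file PROVES the second one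
(`cechComplex_h0_fibre_holds`), so that `grothendieckComplex_h0` and the closedness half of the
seesaw theorem (Görtz–Wedhorn II, Thm. 24.66 (3)) rest on `cechComplex_perfect` alone
(`grothendieckComplex_h0_of_perfect`, `seesaw_isClosed_trivialLocus_of_perfect`).

The proof, for `t ∈ V` and a Čech cover `𝔚 = (W_a)` of `pr_T⁻¹V` (all `W_s = ⋂_{a ∈ s} W_a ∩ pr_T⁻¹V`
affine, `pr_T` being separated, and non-empty):

* `Ker(d⁰ ⊗ κ(t)) ≅` compatible families `(x_a ∈ κ(t) ⊗ Γ(W_a, 𝒪(D)))_a`,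
  `x_a|_{ab} = x_b|_{ab}` in `κ(t) ⊗ Γ(W_{ab}, 𝒪(D))`
  (`Literature.Algebra.Homology.OrderedCech.kerBaseChangeDZeroEquiv`);
* termwise, `κ(t) ⊗_{Γ(V, 𝒪_T)} Γ(W_s, 𝒪(D)) ≅ Γ(W_{s,t}, 𝒪(D_t)) ⊆ K(X_t)` when the fibre part
  `W_{s,t} = fibreι⁻¹W_s` is non-empty, i.e. when `y_t = fibreι(η_{X_t}) ∈ W_s`, by
  `c ⊗ m ↦ c · ι^♯(f_{i₀} m)`, and `κ(t) ⊗ Γ(W_s, 𝒪(D)) = 0` otherwise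
  (`CartierDivisor.fibreSectionsOnEquiv`, `subsingleton_tensorProduct_sectionsOn` of
  `Motives/CartierDivisorFibreSections`; Görtz–Wedhorn II, proof of Thm. 22.90:
  `𝓕(V) ⊗_A A' = 𝓕(u'⁻¹(V), 𝓕')`, and Görtz–Wedhorn I, (11.16)); these are the **fibre maps**
  `CechCover.fibreMap : κ(t) ⊗ Γ(W_s, 𝒪(D)) → K(X_t)`, compatible with the restrictions
  `W_{s'} ⊆ W_s` (`fibreMap_baseChange_inclusion` — the formula does not depend on `s`);
* hence all fibre values `ε_a(x_a)` of a compatible family over the vertices `a` with `y_t ∈ W_a`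
  coincide (`fibreMap_vertex_eq`: apply the injective `ε_{ab}` to the compatibility over the edge;
  `y_t ∈ W_a ∩ W_b ⇒ y_t ∈ W_{ab}`), and this common rational function `familyValue x ∈ K(X_t)` is
  a global section of `𝒪(D_t)` (`isSection_familyValue`: every point of `X_t` lies over some `W_a`,
  whose fibre part then contains `η_{X_t}`) — the sheaf axiom `Γ(X_t, 𝒪(D_t)) = Ȟ⁰((W_{a,t})_a, 𝒪(D_t))`
  for the subsheaf `𝒪(D_t) ⊆ 𝒦_{X_t}` (Görtz–Wedhorn II, Lemma 21.65), made explicit as the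
  `κ(t)`-linear isomorphism `compatibleFamiliesEquivSections` (injective: `ε_a` is injective, and the
  empty fibre parts carry the zero module; surjective: `familyOf φ = (ε_a⁻¹(φ|_{W_{a,t}}))_a`).

Everything here is proved; the only remaining named fact behind Thm. 24.66 (3) in this tree is
`cechComplex_perfect` (finiteness of coherent cohomology of proper morphisms, Görtz–Wedhorn II,
Thm. 23.133, absent from Mathlib). Mathlib searched (pin): `LinearEquiv.ofBijective`,
`LinearMap.codRestrict`, `LinearEquiv.ofEq`, `injective_iff_map_eq_zero`, `TensorProduct.induction_on`
(used); no Čech cohomology of quasi-coherent modules or base change exists in Mathlib.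

## References

* U. Görtz, T. Wedhorn, *Algebraic Geometry II: Cohomology of Schemes*, Springer Spektrum (2023),
  doi:10.1007/978-3-658-43031-3: Lemma 21.65, p. 259; Def. 21.68, p. 260; Thm. 22.9, p. 332; proof
  of Thm. 22.90, p. 388; Cor. 23.135, p. 480; (23.28.5), p. 482; Thm. 24.66 (3), pp. 545–546 (read via
  the held copy). [GortzWedhorn2023]
* U. Görtz, T. Wedhorn, *Algebraic Geometry I: Schemes*, 2nd ed. (2020),
  doi:10.1007/978-3-658-30733-2: (11.9), p. 374; (11.16), p. 392. [GortzWedhorn2020]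
* D. Mumford, *Abelian Varieties*, TIFR Studies in Mathematics 5 (1970), §5 (the Čech complex of an
  `S`-flat sheaf computes the cohomology of all base changes). [MumfordAV1970]
-/

universe u

open CategoryTheory CategoryTheory.Limits AlgebraicGeometry TopologicalSpace Opposite TensorProduct
open MonoidalCategory CartesianMonoidalCategory

noncomputable section

namespace Literature.AlgebraicGeometry.Motives

open Literature.Algebra.Homology Literature.Algebra.Homology.OrderedCech RatFn

namespace CartierDivisor.CechCover

section FibreH0

variable {K : Type u} [Field K]

/-- The image `y_t = fibreι(η_{X_t})` in `X ×_K T` of the generic point of the (irreducible) fibre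
`X_t`. [folklore] -/
abbrev fibreGenericPoint (X T : SchemeOver K) (t : T.left) [IsIntegral (X ⊗ residuePt T t).left] :
    (X ⊗ T).left :=
  fibreι X T t (genericPoint (X ⊗ residuePt T t).left)

/-- `pr_T (fibreι x) = t`. [folklore] -/
theorem snd_fibreι_apply (X T : SchemeOver K) (t : T.left) (x : (X ⊗ residuePt T t).left) :
    (snd X T).left (fibreι X T t x) = t := by
  rw [show (snd X T).left (fibreι X T t x) = ((fibreι X T t) ≫ (snd X T).left) x from rfl,
    (isPullback_fibre X T t).w, Scheme.Hom.comp_apply, Scheme.fromSpecResidueField_apply]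

variable {X T : SchemeOver K} [IsIntegral (X ⊗ T).left] {t : T.left}
  [IsIntegral (X ⊗ residuePt T t).left] {D : CartierDivisor (X ⊗ T).left} {V : T.left.Opens}
  (hV : IsAffineOpen V) [IsSeparated (snd X T).left] (𝔚 : CechCover (snd X T).left V D) (ht : t ∈ V)

include ht in
omit [IsIntegral (X ⊗ T).left] [IsIntegral (X ⊗ residuePt T t).left] [IsSeparated (snd X T).left] in
/-- Every point of the fibre lies over `V` (in `pr_T⁻¹V`). [folklore] -/
theorem fibreι_apply_mem_preimage (x : (X ⊗ residuePt T t).left) :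
    fibreι X T t x ∈ (snd X T).left ⁻¹ᵁ V := by
  show (snd X T).left (fibreι X T t x) ∈ V
  rw [snd_fibreι_apply]
  exact ht

include ht in
omit [IsIntegral (X ⊗ residuePt T t).left] [IsSeparated (snd X T).left] in
/-- Every point of the fibre lies in some `fibreι⁻¹ W_a`. [folklore] -/
theorem exists_fibreι_apply_mem_W (x : (X ⊗ residuePt T t).left) : ∃ a, fibreι X T t x ∈ 𝔚.W a := by
  have hx : fibreι X T t x ∈ (⨆ a, 𝔚.W a : (X ⊗ T).left.Opens) := by
    rw [𝔚.iSup_W]; exact fibreι_apply_mem_preimage ht x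
  exact Opens.mem_iSup.1 hx

include ht in
omit [IsSeparated (snd X T).left] in
/-- If `x ∈ fibreι⁻¹ W_a` then `y_t ∈ W_{a}` (`= pr⁻¹V ∩ W_a`). [folklore] -/
theorem fibreGenericPoint_mem_opens_singleton {x : (X ⊗ residuePt T t).left} {a : Fin (𝔚.r + 1)}
    (hx : fibreι X T t x ∈ 𝔚.W a) : fibreGenericPoint X T t ∈ 𝔚.opens {a} := by
  rw [mem_opens_iff]
  refine ⟨fibreι_apply_mem_preimage ht _, fun b hb => ?_⟩
  rw [Finset.mem_singleton] at hb
  subst hb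
  exact genericPoint_mem_of_mem (U := fibreι X T t ⁻¹ᵁ 𝔚.W b) hx

omit [IsSeparated (snd X T).left] in
/-- `y_t ∈ W_s` and `y_t ∈ W_{s'}` give `y_t ∈ W_{s ∪ s'}`. [folklore] -/
theorem fibreGenericPoint_mem_opens_union {s s' : Finset (Fin (𝔚.r + 1))}
    (hs : fibreGenericPoint X T t ∈ 𝔚.opens s) (hs' : fibreGenericPoint X T t ∈ 𝔚.opens s') :
    fibreGenericPoint X T t ∈ 𝔚.opens (s ∪ s') := by
  classical
  rw [mem_opens_iff] at hs hs' ⊢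
  refine ⟨hs.1, fun b hb => ?_⟩
  rcases Finset.mem_union.1 hb with h | h
  · exact hs.2 b h
  · exact hs'.2 b h

/-! #### The fibre maps `ε_s : κ(t) ⊗ Γ(W_s, 𝒪(D)) → K(X_t)` -/

open scoped Classical in
/-- **The fibre map on `κ(t) ⊗_{Γ(V, 𝒪_T)} Γ(W_s, 𝒪(D))`**: the restriction of rational sections to
the fibre, `c ⊗ m ↦ c · ι^♯(f_{i₀} m) ∈ K(X_t)` — i.e. `fibreSectionsOnEquiv` followed by the
inclusion `Γ(W_{s,t}, 𝒪(D_t)) ⊆ K(X_t)` — when `y_t ∈ W_s` (`s ≠ ∅`), and `0` otherwise (then the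
source is `0`, `subsingleton_tensorProduct_sectionsOn`). [folklore] -/
def fibreMap (s : Finset (Fin (𝔚.r + 1))) :
    letI := baseAlgebra (snd X T).left V 𝔚.genericPoint_mem
    letI := evalAlgebra T t ht
    letI := fibreOverResidueField X T t
    T.left.residueField t ⊗[Γ(T.left, V)] 𝔚.sectionsOn s →ₗ[T.left.residueField t]
      (X ⊗ residuePt T t).left.functionField :=
  letI := baseAlgebra (snd X T).left V 𝔚.genericPoint_mem
  letI := evalAlgebra T t ht
  letI := fibreOverResidueField X T t
  if h : s.Nonempty ∧ fibreGenericPoint X T t ∈ 𝔚.opens s then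
    (Submodule.subtype _).comp (D.fibreSectionsOnEquiv ht (𝔚.opens_le s) 𝔚.genericPoint_mem hV
      (𝔚.isAffineOpen_opens hV h.1) ((𝔚.opens_le_W h.1.choose_spec).trans (𝔚.W_le_U _))
      h.2).toLinearMap
  else 0

/-- On pure tensors, for `y_t ∈ W_s`: `ε_s (c ⊗ m) = c · ι^♯(f_{i₀} m)`. [folklore] -/
theorem fibreMap_tmul {s : Finset (Fin (𝔚.r + 1))} (hs : s.Nonempty)
    (hy : fibreGenericPoint X T t ∈ 𝔚.opens s) (c : T.left.residueField t)
    (m : letI := baseAlgebra (snd X T).left V 𝔚.genericPoint_mem; 𝔚.sectionsOn s) :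
    letI := baseAlgebra (snd X T).left V 𝔚.genericPoint_mem
    letI := evalAlgebra T t ht
    letI := fibreOverResidueField X T t
    𝔚.fibreMap hV ht s (c ⊗ₜ m) = c • D.fibreFn (fibreι X T t) (m : (X ⊗ T).left.functionField) := by
  letI := baseAlgebra (snd X T).left V 𝔚.genericPoint_mem
  letI := evalAlgebra T t ht
  letI := fibreOverResidueField X T t
  unfold fibreMap
  rw [dif_pos ⟨hs, hy⟩]
  exact D.coe_fibreSectionsOnEquiv_tmul ht (𝔚.opens_le s) 𝔚.genericPoint_mem hV
    (𝔚.isAffineOpen_opens hV hs) _ hy c m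

/-- For `y_t ∈ W_s` the fibre map `ε_s` is injective. [folklore] -/
theorem fibreMap_injective {s : Finset (Fin (𝔚.r + 1))} (hs : s.Nonempty)
    (hy : fibreGenericPoint X T t ∈ 𝔚.opens s) : Function.Injective (𝔚.fibreMap hV ht s) := by
  letI := baseAlgebra (snd X T).left V 𝔚.genericPoint_mem
  letI := evalAlgebra T t ht
  letI := fibreOverResidueField X T t
  unfold fibreMap
  rw [dif_pos ⟨hs, hy⟩]
  exact Subtype.val_injective.comp (LinearEquiv.injective _)

/-- For `y_t ∈ W_s` the fibre map `ε_s` takes values in `Γ(W_{s,t}, 𝒪(D_t))`. [folklore] -/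
theorem isSectionOn_fibreMap {s : Finset (Fin (𝔚.r + 1))} (hs : s.Nonempty)
    (hy : fibreGenericPoint X T t ∈ 𝔚.opens s)
    (z : letI := baseAlgebra (snd X T).left V 𝔚.genericPoint_mem; letI := evalAlgebra T t ht;
      T.left.residueField t ⊗[Γ(T.left, V)] 𝔚.sectionsOn s) :
    (D.classPullback (fibreι X T t)).IsSectionOn (fibreι X T t ⁻¹ᵁ 𝔚.opens s)
      (𝔚.fibreMap hV ht s z) := by
  letI := baseAlgebra (snd X T).left V 𝔚.genericPoint_mem
  letI := evalAlgebra T t ht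
  letI := fibreOverResidueField X T t
  unfold fibreMap
  rw [dif_pos ⟨hs, hy⟩]
  exact (D.fibreSectionsOnEquiv ht (𝔚.opens_le s) 𝔚.genericPoint_mem hV
    (𝔚.isAffineOpen_opens hV hs) _ hy z).2

/-- For `y_t ∈ W_s` every section of `𝒪(D_t)` over `W_{s,t}` is a value of `ε_s`. [folklore] -/
theorem exists_fibreMap_eq {s : Finset (Fin (𝔚.r + 1))} (hs : s.Nonempty)
    (hy : fibreGenericPoint X T t ∈ 𝔚.opens s) {φ : (X ⊗ residuePt T t).left.functionField}
    (hφ : (D.classPullback (fibreι X T t)).IsSectionOn (fibreι X T t ⁻¹ᵁ 𝔚.opens s) φ) :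
    ∃ z, 𝔚.fibreMap hV ht s z = φ := by
  letI := baseAlgebra (snd X T).left V 𝔚.genericPoint_mem
  letI := evalAlgebra T t ht
  letI := fibreOverResidueField X T t
  set e := D.fibreSectionsOnEquiv ht (𝔚.opens_le s) 𝔚.genericPoint_mem hV
    (𝔚.isAffineOpen_opens hV hs) ((𝔚.opens_le_W hs.choose_spec).trans (𝔚.W_le_U _)) hy with he
  refine ⟨e.symm ⟨φ, hφ⟩, ?_⟩
  unfold fibreMap
  rw [dif_pos ⟨hs, hy⟩, ← he]
  change ((e (e.symm ⟨φ, hφ⟩) : (D.classPullback (fibreι X T t)).sectionsOn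
    (A := T.left.residueField t) (fibreι X T t ⁻¹ᵁ 𝔚.opens s)
    (fun c _ _ => isRegularAt_algebraMap _ c)) : (X ⊗ residuePt T t).left.functionField) = φ
  rw [LinearEquiv.apply_symm_apply]

include hV in
/-- If `y_t ∉ W_s` (`s ≠ ∅`) then `κ(t) ⊗ Γ(W_s, 𝒪(D)) = 0`. [folklore] -/
theorem subsingleton_of_notMem {s : Finset (Fin (𝔚.r + 1))} (hs : s.Nonempty)
    (hy : fibreGenericPoint X T t ∉ 𝔚.opens s) :
    letI := baseAlgebra (snd X T).left V 𝔚.genericPoint_mem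
    letI := evalAlgebra T t ht
    Subsingleton (T.left.residueField t ⊗[Γ(T.left, V)] 𝔚.sectionsOn s) :=
  D.subsingleton_tensorProduct_sectionsOn ht (𝔚.opens_le s) 𝔚.genericPoint_mem hV
    (𝔚.isAffineOpen_opens hV hs) ((𝔚.opens_le_W hs.choose_spec).trans (𝔚.W_le_U _))
    (𝔚.genericPoint_mem_opens s) hy

/-- **Compatibility of the fibre maps with restriction**: for `s ⊆ s'` with `y_t ∈ W_{s'}`,
`ε_{s'} ∘ (κ(t) ⊗ (Γ(W_s, 𝒪(D)) ⊆ Γ(W_{s'}, 𝒪(D)))) = ε_s` — both are `c ⊗ m ↦ c · ι^♯(f_{i₀} m)`.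
[folklore] -/
theorem fibreMap_baseChange_inclusion {s s' : Finset (Fin (𝔚.r + 1))} (hs : s.Nonempty)
    (hss' : s ⊆ s') (hy' : fibreGenericPoint X T t ∈ 𝔚.opens s')
    (z : letI := baseAlgebra (snd X T).left V 𝔚.genericPoint_mem; letI := evalAlgebra T t ht;
      T.left.residueField t ⊗[Γ(T.left, V)] 𝔚.sectionsOn s) :
    letI := baseAlgebra (snd X T).left V 𝔚.genericPoint_mem
    letI := evalAlgebra T t ht
    𝔚.fibreMap hV ht s' ((Submodule.inclusion (𝔚.sectionsOn_mono hss')).baseChange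
      (T.left.residueField t) z) = 𝔚.fibreMap hV ht s z := by
  letI := baseAlgebra (snd X T).left V 𝔚.genericPoint_mem
  letI := evalAlgebra T t ht
  letI := fibreOverResidueField X T t
  have hy : fibreGenericPoint X T t ∈ 𝔚.opens s := 𝔚.opens_anti hss' hy'
  have hs' : s'.Nonempty := hs.mono hss'
  induction z using TensorProduct.induction_on with
  | zero => simp only [map_zero]
  | add x y hx hy2 => simp only [map_add, hx, hy2]
  | tmul c m =>
    rw [LinearMap.baseChange_tmul, fibreMap_tmul _ _ _ hs' hy', fibreMap_tmul _ _ _ hs hy]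
    rfl

/-! #### Compatible families of the base-changed Čech complex are the sections of `𝒪(D_t)` -/

include ht in
omit [IsSeparated (snd X T).left] in
/-- Some member `W_{a₀}` of the cover contains `y_t`. [folklore] -/
theorem exists_fibreGenericPoint_mem_opens_singleton :
    ∃ a, fibreGenericPoint X T t ∈ 𝔚.opens {a} := by
  obtain ⟨a, ha⟩ := 𝔚.exists_fibreι_apply_mem_W ht (genericPoint _)
  exact ⟨a, 𝔚.fibreGenericPoint_mem_opens_singleton ht ha⟩

/-- A chosen index `a₀` with `y_t ∈ W_{a₀}`. [folklore] -/
def baseVertex : Fin (𝔚.r + 1) := (𝔚.exists_fibreGenericPoint_mem_opens_singleton ht).choose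

omit [IsSeparated (snd X T).left] in
/-- `y_t ∈ W_{a₀}`. [folklore] -/
theorem fibreGenericPoint_mem_opens_baseVertex :
    fibreGenericPoint X T t ∈ 𝔚.opens {𝔚.baseVertex ht} :=
  (𝔚.exists_fibreGenericPoint_mem_opens_singleton ht).choose_spec

/-- **The rational function of a compatible family** `x = (x_σ)_σ` of the base-changed Čech complex:
the common value `ε_{a}(x_{a}) ∈ K(X_t)` over the vertices `a` with `y_t ∈ W_a`
(`fibreMap_vertex_eq`), read off at the chosen vertex `a₀`. [folklore] -/
def familyValue :
    letI := baseAlgebra (snd X T).left V 𝔚.genericPoint_mem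
    letI := evalAlgebra T t ht
    letI := fibreOverResidueField X T t
    compatibleFamilies 𝔚.sectionsOn 𝔚.sectionsOn_mono (T.left.residueField t) →ₗ[T.left.residueField t]
      (X ⊗ residuePt T t).left.functionField :=
  letI := baseAlgebra (snd X T).left V 𝔚.genericPoint_mem
  letI := evalAlgebra T t ht
  letI := fibreOverResidueField X T t
  𝔚.fibreMap hV ht {𝔚.baseVertex ht} ∘ₗ LinearMap.proj (vertex (𝔚.baseVertex ht)) ∘ₗ
    (compatibleFamilies 𝔚.sectionsOn 𝔚.sectionsOn_mono (T.left.residueField t)).subtype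

/-- `familyValue x = ε_{a₀} (x_{a₀})`. [folklore] -/
theorem familyValue_apply
    (x : letI := baseAlgebra (snd X T).left V 𝔚.genericPoint_mem; letI := evalAlgebra T t ht;
      compatibleFamilies 𝔚.sectionsOn 𝔚.sectionsOn_mono (T.left.residueField t)) :
    𝔚.familyValue hV ht x = 𝔚.fibreMap hV ht {𝔚.baseVertex ht} (x.1 (vertex (𝔚.baseVertex ht))) :=
  rfl

/-- Transport of `ε_σ (x_σ)` along an equality of vertices. [folklore] -/
theorem fibreMap_congr_vertex
    (x : letI := baseAlgebra (snd X T).left V 𝔚.genericPoint_mem; letI := evalAlgebra T t ht;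
      ∀ σ : Simplex (Fin (𝔚.r + 1)) 0, T.left.residueField t ⊗[Γ(T.left, V)] 𝔚.sectionsOn σ.1)
    {σ σ' : Simplex (Fin (𝔚.r + 1)) 0} (h : σ = σ') :
    𝔚.fibreMap hV ht σ.1 (x σ) = 𝔚.fibreMap hV ht σ'.1 (x σ') := by
  subst h; rfl

/-- For a compatible family and vertices `a < b` with `y_t ∈ W_a ∩ W_b`:
`ε_a (x_a) = ε_b (x_b)` (apply `ε_{ab}` to the compatibility over the edge `{a, b}`). [folklore] -/
theorem fibreMap_vertex_eq_of_lt
    (x : letI := baseAlgebra (snd X T).left V 𝔚.genericPoint_mem; letI := evalAlgebra T t ht;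
      compatibleFamilies 𝔚.sectionsOn 𝔚.sectionsOn_mono (T.left.residueField t))
    {a b : Fin (𝔚.r + 1)} (hab : a < b) (ha : fibreGenericPoint X T t ∈ 𝔚.opens {a})
    (hb : fibreGenericPoint X T t ∈ 𝔚.opens {b}) :
    𝔚.fibreMap hV ht {a} (x.1 (vertex a)) = 𝔚.fibreMap hV ht {b} (x.1 (vertex b)) := by
  letI := baseAlgebra (snd X T).left V 𝔚.genericPoint_mem
  letI := evalAlgebra T t ht
  have hτ : fibreGenericPoint X T t ∈ 𝔚.opens (edge a b hab).1 := by
    rw [edge_val, ← Finset.singleton_union]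
    exact 𝔚.fibreGenericPoint_mem_opens_union ha hb
  have hc := (mem_compatibleFamilies_iff 𝔚.sectionsOn 𝔚.sectionsOn_mono
    (T.left.residueField t)).1 x.2 (edge a b hab)
  have hc' := congrArg (𝔚.fibreMap hV ht (edge a b hab).1) hc
  rw [srcMap, tgtMap, 𝔚.fibreMap_baseChange_inclusion hV ht (src (edge a b hab)).2.1
      (src_val_subset _) hτ,
    𝔚.fibreMap_baseChange_inclusion hV ht (tgt (edge a b hab)).2.1 (tgt_val_subset _) hτ] at hc'
  rw [𝔚.fibreMap_congr_vertex hV ht x.1 (src_edge a b hab),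
    𝔚.fibreMap_congr_vertex hV ht x.1 (tgt_edge a b hab)] at hc'
  exact hc'

/-- **All fibre values of a compatible family agree**: `ε_a (x_a) = ε_b (x_b)` whenever
`y_t ∈ W_a ∩ W_b`. [folklore] -/
theorem fibreMap_vertex_eq
    (x : letI := baseAlgebra (snd X T).left V 𝔚.genericPoint_mem; letI := evalAlgebra T t ht;
      compatibleFamilies 𝔚.sectionsOn 𝔚.sectionsOn_mono (T.left.residueField t))
    {a b : Fin (𝔚.r + 1)} (ha : fibreGenericPoint X T t ∈ 𝔚.opens {a})
    (hb : fibreGenericPoint X T t ∈ 𝔚.opens {b}) :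
    𝔚.fibreMap hV ht {a} (x.1 (vertex a)) = 𝔚.fibreMap hV ht {b} (x.1 (vertex b)) := by
  rcases lt_trichotomy a b with h | rfl | h
  · exact 𝔚.fibreMap_vertex_eq_of_lt hV ht x h ha hb
  · rfl
  · exact (𝔚.fibreMap_vertex_eq_of_lt hV ht x h hb ha).symm

/-- `familyValue x = ε_a (x_a)` for every vertex `a` with `y_t ∈ W_a`. [folklore] -/
theorem familyValue_eq_fibreMap
    (x : letI := baseAlgebra (snd X T).left V 𝔚.genericPoint_mem; letI := evalAlgebra T t ht;
      compatibleFamilies 𝔚.sectionsOn 𝔚.sectionsOn_mono (T.left.residueField t))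
    {a : Fin (𝔚.r + 1)} (ha : fibreGenericPoint X T t ∈ 𝔚.opens {a}) :
    𝔚.familyValue hV ht x = 𝔚.fibreMap hV ht {a} (x.1 (vertex a)) :=
  𝔚.fibreMap_vertex_eq hV ht x (𝔚.fibreGenericPoint_mem_opens_baseVertex ht) ha

include ht in
omit [IsIntegral (X ⊗ residuePt T t).left] [IsSeparated (snd X T).left] in
/-- A point of the fibre over `W_a` lies in `fibreι⁻¹ W_{a}`. [folklore] -/
theorem mem_preimage_opens_singleton {y : (X ⊗ residuePt T t).left} {a : Fin (𝔚.r + 1)}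
    (hy : fibreι X T t y ∈ 𝔚.W a) : y ∈ fibreι X T t ⁻¹ᵁ 𝔚.opens {a} := by
  show fibreι X T t y ∈ 𝔚.opens {a}
  rw [mem_opens_iff]
  refine ⟨fibreι_apply_mem_preimage ht y, fun b hb => ?_⟩
  rw [Finset.mem_singleton] at hb
  subst hb
  exact hy

/-- **The rational function of a compatible family is a global section of `𝒪(D_t)`**: near a point
`y ∈ X_t`, lying over some `W_a`, it is `ε_a (x_a) ∈ Γ(W_{a,t}, 𝒪(D_t))`. [folklore] -/
theorem isSection_familyValue
    (x : letI := baseAlgebra (snd X T).left V 𝔚.genericPoint_mem; letI := evalAlgebra T t ht;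
      compatibleFamilies 𝔚.sectionsOn 𝔚.sectionsOn_mono (T.left.residueField t)) :
    (D.classPullback (fibreι X T t)).IsSection (𝔚.familyValue hV ht x) := by
  intro j y hj
  obtain ⟨a, ha⟩ := 𝔚.exists_fibreι_apply_mem_W ht y
  have hya := 𝔚.fibreGenericPoint_mem_opens_singleton ht ha
  rw [𝔚.familyValue_eq_fibreMap hV ht x hya]
  exact 𝔚.isSectionOn_fibreMap hV ht (Finset.singleton_nonempty a) hya _ j y hj
    (𝔚.mem_preimage_opens_singleton ht ha)

/-- **A compatible family with rational function `0` is `0`** (componentwise: `ε_a` is injective when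
`y_t ∈ W_a`, and `κ(t) ⊗ Γ(W_a, 𝒪(D)) = 0` otherwise). [folklore] -/
theorem eq_zero_of_familyValue_eq_zero
    (x : letI := baseAlgebra (snd X T).left V 𝔚.genericPoint_mem; letI := evalAlgebra T t ht;
      compatibleFamilies 𝔚.sectionsOn 𝔚.sectionsOn_mono (T.left.residueField t))
    (hx : 𝔚.familyValue hV ht x = 0) : x = 0 := by
  letI := baseAlgebra (snd X T).left V 𝔚.genericPoint_mem
  letI := evalAlgebra T t ht
  apply Subtype.ext
  funext σ
  obtain ⟨a, rfl⟩ := exists_eq_vertex σ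
  by_cases hya : fibreGenericPoint X T t ∈ 𝔚.opens {a}
  · rw [𝔚.familyValue_eq_fibreMap hV ht x hya] at hx
    apply 𝔚.fibreMap_injective hV ht (Finset.singleton_nonempty a) hya
    change 𝔚.fibreMap hV ht {a} (x.1 (vertex a)) = 𝔚.fibreMap hV ht {a} 0
    rw [map_zero]
    exact hx
  · exact @Subsingleton.elim _ (𝔚.subsingleton_of_notMem hV ht (Finset.singleton_nonempty a) hya) _ _

open scoped Classical in
/-- The compatible family of a global section `φ` of `𝒪(D_t)`: `x_σ = ε_σ⁻¹(φ|_{W_{σ,t}})` when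
`y_t ∈ W_σ`, and `0` otherwise. [folklore] -/
def familyOf (φ : (X ⊗ residuePt T t).left.functionField)
    (hφ : (D.classPullback (fibreι X T t)).IsSection φ) :
    letI := baseAlgebra (snd X T).left V 𝔚.genericPoint_mem
    letI := evalAlgebra T t ht
    ∀ σ : Simplex (Fin (𝔚.r + 1)) 0, T.left.residueField t ⊗[Γ(T.left, V)] 𝔚.sectionsOn σ.1 :=
  fun σ => if h : fibreGenericPoint X T t ∈ 𝔚.opens σ.1 then
    (𝔚.exists_fibreMap_eq hV ht σ.2.1 h (hφ.isSectionOn _)).choose else 0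

/-- `ε_σ (familyOf φ σ) = φ` when `y_t ∈ W_σ`. [folklore] -/
theorem fibreMap_familyOf {φ : (X ⊗ residuePt T t).left.functionField}
    (hφ : (D.classPullback (fibreι X T t)).IsSection φ) (σ : Simplex (Fin (𝔚.r + 1)) 0)
    (h : fibreGenericPoint X T t ∈ 𝔚.opens σ.1) :
    𝔚.fibreMap hV ht σ.1 (𝔚.familyOf hV ht φ hφ σ) = φ := by
  unfold familyOf
  rw [dif_pos h]
  exact (𝔚.exists_fibreMap_eq hV ht σ.2.1 h (hφ.isSectionOn _)).choose_spec

/-- `familyOf φ` is a compatible family. [folklore] -/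
theorem familyOf_mem {φ : (X ⊗ residuePt T t).left.functionField}
    (hφ : (D.classPullback (fibreι X T t)).IsSection φ) :
    letI := baseAlgebra (snd X T).left V 𝔚.genericPoint_mem
    letI := evalAlgebra T t ht
    𝔚.familyOf hV ht φ hφ ∈ compatibleFamilies 𝔚.sectionsOn 𝔚.sectionsOn_mono
      (T.left.residueField t) := by
  letI := baseAlgebra (snd X T).left V 𝔚.genericPoint_mem
  letI := evalAlgebra T t ht
  rw [mem_compatibleFamilies_iff]
  intro τ
  by_cases hτ : fibreGenericPoint X T t ∈ 𝔚.opens τ.1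
  · apply 𝔚.fibreMap_injective hV ht τ.2.1 hτ
    rw [srcMap, tgtMap, 𝔚.fibreMap_baseChange_inclusion hV ht (src τ).2.1 (src_val_subset _) hτ,
      𝔚.fibreMap_baseChange_inclusion hV ht (tgt τ).2.1 (tgt_val_subset _) hτ,
      𝔚.fibreMap_familyOf hV ht hφ _ (𝔚.opens_anti (src_val_subset τ) hτ),
      𝔚.fibreMap_familyOf hV ht hφ _ (𝔚.opens_anti (tgt_val_subset τ) hτ)]
  · haveI := 𝔚.subsingleton_of_notMem hV ht τ.2.1 hτ
    exact Subsingleton.elim _ _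

/-- `familyValue (familyOf φ) = φ`. [folklore] -/
theorem familyValue_familyOf {φ : (X ⊗ residuePt T t).left.functionField}
    (hφ : (D.classPullback (fibreι X T t)).IsSection φ) :
    𝔚.familyValue hV ht ⟨𝔚.familyOf hV ht φ hφ, 𝔚.familyOf_mem hV ht hφ⟩ = φ := by
  rw [familyValue_apply]
  exact 𝔚.fibreMap_familyOf hV ht hφ (vertex _) (𝔚.fibreGenericPoint_mem_opens_baseVertex ht)

/-- **`Ȟ⁰` of the base-changed Čech complex is `Γ(X_t, 𝒪(D_t))`**: the compatible families of
`Č•(𝔚, 𝒪(D)) ⊗_{Γ(V, 𝒪_T)} κ(t)` (`OrderedCech.compatibleFamilies`) are, through their rational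
functions, exactly the global sections `Γ(X_t, 𝒪_{X_t}(D_t)) ⊆ K(X_t)` (`CartierDivisor.sections`) —
the sheaf axiom for `𝒪(D_t) ⊆ 𝒦` on the cover `(W_{a,t})_a` of `X_t` (Görtz–Wedhorn II, Lemma 21.65:
`Γ(U, 𝓕) ⥲ Ȟ⁰(𝓤, 𝓕)`) combined with the termwise identification `fibreSectionsOnEquiv`
(Görtz–Wedhorn II, proof of Thm. 22.90: `𝓕(V) ⊗_A A' = 𝓕(u'⁻¹(V), 𝓕')`).
[cite: GortzWedhorn2023, Lemma 21.65 (p. 259) and Thm. 22.90, proof (p. 388)] -/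
def compatibleFamiliesEquivSections :
    letI := baseAlgebra (snd X T).left V 𝔚.genericPoint_mem
    letI := evalAlgebra T t ht
    letI := fibreOverResidueField X T t
    compatibleFamilies 𝔚.sectionsOn 𝔚.sectionsOn_mono (T.left.residueField t) ≃ₗ[T.left.residueField t]
      (D.classPullback (fibreι X T t)).sections (T.left.residueField t) :=
  letI := baseAlgebra (snd X T).left V 𝔚.genericPoint_mem
  letI := evalAlgebra T t ht
  letI := fibreOverResidueField X T t
  LinearEquiv.ofBijective
    (LinearMap.codRestrict ((D.classPullback (fibreι X T t)).sections (T.left.residueField t))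
      (𝔚.familyValue hV ht) (𝔚.isSection_familyValue hV ht))
    ⟨(injective_iff_map_eq_zero _).2 fun x hx =>
        𝔚.eq_zero_of_familyValue_eq_zero hV ht x (congrArg Subtype.val hx),
      fun φ => ⟨⟨𝔚.familyOf hV ht φ.1 φ.2, 𝔚.familyOf_mem hV ht φ.2⟩,
        Subtype.ext (𝔚.familyValue_familyOf hV ht φ.2)⟩⟩

/-- The isomorphism on elements: the rational function of the family. [folklore] -/
theorem coe_compatibleFamiliesEquivSections
    (x : letI := baseAlgebra (snd X T).left V 𝔚.genericPoint_mem; letI := evalAlgebra T t ht;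
      compatibleFamilies 𝔚.sectionsOn 𝔚.sectionsOn_mono (T.left.residueField t)) :
    letI := fibreOverResidueField X T t
    ((𝔚.compatibleFamiliesEquivSections hV ht x :
      (D.classPullback (fibreι X T t)).sections (T.left.residueField t)) :
        (X ⊗ residuePt T t).left.functionField) = 𝔚.familyValue hV ht x :=
  rfl

omit [IsSeparated (snd X T).left] in
/-- The first differential of `Č•(𝔚, 𝒪(D))` is the ordered Čech differential `d⁰`. [folklore] -/
theorem complex_d_zero_one_hom :
    letI := baseAlgebra (snd X T).left V 𝔚.genericPoint_mem
    (𝔚.complex.d 0 1).hom = OrderedCech.d 𝔚.sectionsOn 𝔚.sectionsOn_mono 0 := by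
  letI := baseAlgebra (snd X T).left V 𝔚.genericPoint_mem
  change ((OrderedCech.complex 𝔚.sectionsOn 𝔚.sectionsOn_mono).d 0 (0 + 1)).hom = _
  rw [OrderedCech.complex_d]
  rfl

/-- **`H⁰(X_t, 𝒪(D_t)) ≅ Ker(d⁰_Č ⊗ κ(t))`** for the Čech complex of `𝒪(D)` over an affine `V ∋ t` and
a Čech cover `𝔚` (with `pr_T` separated): the composite of `Ker(d⁰ ⊗ κ(t)) ≅` compatible families
(`OrderedCech.kerBaseChangeDZeroEquiv`) and `compatibleFamiliesEquivSections`. [cite: GortzWedhorn2023, (23.28.5) (p. 482) with Lemma 21.65 (p. 259)] -/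
def sectionsEquivKerBaseChange :
    letI := baseAlgebra (snd X T).left V 𝔚.genericPoint_mem
    letI := evalAlgebra T t ht
    letI := fibreOverResidueField X T t
    (D.classPullback (fibreι X T t)).sections (T.left.residueField t) ≃ₗ[T.left.residueField t]
      LinearMap.ker ((𝔚.complex.d 0 1).hom.baseChange (T.left.residueField t)) :=
  letI := baseAlgebra (snd X T).left V 𝔚.genericPoint_mem
  letI := evalAlgebra T t ht
  letI := fibreOverResidueField X T t
  ((LinearEquiv.ofEq _ (LinearMap.ker ((OrderedCech.d 𝔚.sectionsOn 𝔚.sectionsOn_mono 0).baseChange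
      (T.left.residueField t))) (by rw [𝔚.complex_d_zero_one_hom]; rfl)).trans
    ((kerBaseChangeDZeroEquiv 𝔚.sectionsOn 𝔚.sectionsOn_mono (T.left.residueField t)).trans
      (𝔚.compatibleFamiliesEquivSections hV ht))).symm

end FibreH0

end CartierDivisor.CechCover

/-! ### Discharge of `cechComplex_h0_fibre` and the Grothendieck complex from perfectness alone -/

/-- **`cechComplex_h0_fibre` holds** (Görtz–Wedhorn II, (23.28.5) in degree `0` for `𝓕 = 𝒪(D)`: the
Čech complex of `𝒪(D)` over an affine `V` computes `H⁰(X_t, 𝒪(D_t))` after base change to `κ(t)`):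
discharge of the named fact of `Motives/GrothendieckComplexCech`, by
`CechCover.sectionsEquivKerBaseChange` (`pr_T` is separated, `X → Spec K` being proper).
[cite: GortzWedhorn2023, (23.28.5) (p. 482) with Lemma 21.65 (p. 259) and Thm. 22.90, proof (p. 388)] -/
theorem cechComplex_h0_fibre_holds : cechComplex_h0_fibre.{u} := by
  intro K _ X T _ _ _ _ D V hV 𝔚 t ht
  haveI := isSeparated_snd_left X T
  exact ⟨𝔚.sectionsEquivKerBaseChange hV ht⟩

/-- **The Grothendieck complex in degree `0` from the perfectness of the Čech complex alone**:
`grothendieckComplex_h0` (`Motives/SemicontinuityGrothendieckComplex`) follows from the single named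
fact `cechComplex_perfect` (Görtz–Wedhorn II, Cor. 23.135 / Thm. 23.133 for the Čech complex of
`𝒪(D)`), the fibre identification being proved (`cechComplex_h0_fibre_holds`,
`grothendieckComplex_h0_of_cech`). [cite: GortzWedhorn2023, Cor. 23.135 with (23.28.5) (pp. 480–482)] -/
theorem grothendieckComplex_h0_of_perfect (h : cechComplex_perfect.{u}) : grothendieckComplex_h0.{u} :=
  grothendieckComplex_h0_of_cech h cechComplex_h0_fibre_holds

/-- **Thm. 24.66 (3) (closedness of the trivial locus) conditional on the perfectness of the Čech
complex of `𝒪(D)` only.** [cite: GortzWedhorn2023, Thm. 24.66 (3), proof (pp. 545–546)] -/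
theorem seesaw_isClosed_trivialLocus_of_perfect (h : cechComplex_perfect.{u}) :
    seesaw_isClosed_trivialLocus.{u} :=
  seesaw_isClosed_trivialLocus_of_grothendieckComplex (grothendieckComplex_h0_of_perfect h)

end Literature.AlgebraicGeometry.Motives

end
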